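import Summits.AtomisticToContinuum.Crystallization.Theorems.OverbindingBudgetLimitChargeFreeBall

/-!
# OverbindingBudget — E_per cut to the LAYERED MODEL: «uniformly clean or strained» (lens-4 g28, part X; critic row 416 (3)(c) plan)

Helper file (`--supports stmt-AtomisticToContinuum-31280`).  The Liouville leaf of the RDEF cone was cut at two-periodicity (part VI): the
energy half is E_per `PeriodicStrainedCubes Λ T₀ D` — a two-periodic texture of the L_opt class carrying `t`-robust `RT`-violators `L`-densely at
every admissible spacing has strained cubes.  Here E_per is (i) freed of the violator bookkeeping and (ii) moved onto the tree's EXACT LAYERED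
MODEL `Layered a b w` (`isLayered_iff_twoPeriodic_of_isSep`, landed), which is where the homogeneous-strain plan lives.

* `UniformlyClean Y` (§1): ONE admissible spacing `a' ∈ [47/50, 1]` at which EVERY site passes the relaxed gapped-twelve test `RT a' s` at
  EVERY margin `s > 0`.  A uniformly clean texture has no `t`-robust violator at spacing `a'`, for any `t > 0` (`not_violatorsL_of_uniformlyClean`).
* **`PeriodicCleanOrStrained Λ T₀ D`** (§1): a two-periodic texture of the L_opt class (clean, uncompressed, sparse charge, locally optimal) is
  uniformly clean OR has strained cubes.  KERNEL-STRONGER than E_per (`periodicStrainedCubes_of_cleanOrStrained`, PROVED).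
* **`LayeredCleanOrStrained Λ T₀ D`** (§1) — the same dichotomy stated on the MODEL: for independent in-plane generators `a, b` of length
  `≤ Λ` and free per-layer translations `w : ℤ → ℝ³`, the layered structure `Layered a b w`, if it is of the L_opt class, is uniformly clean or
  strained.  `LayeredCleanOrStrained → PeriodicCleanOrStrained` for `T₀ ≤ 1/2` (`periodicCleanOrStrained_of_layered`, PROVED: a clean texture
  is `((47/50)(49/50) − T₀)`-separated and rooted, so the landed `isLayered_iff_twoPeriodic_of_isSep` applies).  [piece; ATTACKABLE·L —
  the homogeneous-strain plan: in `Layered a b w` all sites of a layer are lattice translates of one another, so (1) cleanliness makes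
  `ℤa + ℤb` contain a near-triangular primitive lattice and puts adjacent layers at hollow-type offsets and window spacings, (2) local
  optimality makes the offsets exact hollow sites and the spacings uniform (layer force balance `f(h_m) = f(h_{m+1})` plus finite-surgery
  stability), (3) for the resulting homogeneous cell `(a, b, h)` either every site is `RT a' s`-clean at the common spacing `a' = ` nearest-
  neighbour distance for all `s > 0` (window `±2 %` against equilibrium anisotropies `≈ 10⁻⁴`), or the cell is `≥ 2 %` distorted and then
  `¬VirialBalanced ∨ ¬StressFree` by convexity of the cell energy on the window (census TAG 141 (a): `e″(a⋆) = 54.77`/site in the dilation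
  direction), whence strained cubes by the landed `strainedCubes_of_not_virialBalanced` / shear test.]
* CONE `rdef_of_grossU_doorPeriodic_layered Λ : GrossCleanBallsU (1/250) 10 → ChargedEnergyGap → CompressedVirialLaw (1/250) 10 →
  LocalTwoShellRigidity (1/250) 10 → CleanCharted (1/250) 10 → DoorPeriodic Λ → LayeredCleanOrStrained Λ (1/250) 10 → CleanlessExcessT →
  CoherentResidual 10 → RobustDefectLimitWindows`.
-/

namespace Summit.AtomisticToContinuum.Crystallization.Theorems.OverbindingBudgetPeriodicCleanOrStrained

open Summit.AtomisticToContinuum.Crystallization.Theses.OverbindingBudget (RobustDefectLimitWindows)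
open Summit.AtomisticToContinuum.Crystallization.Theses.PricedLinkCensus (ChargedEnergyGap)
open Summit.AtomisticToContinuum.Crystallization.Theorems.OverbindingBudgetGradedBareness (CleanlessExcessT)
open Summit.AtomisticToContinuum.Crystallization.Theorems.OverbindingBudgetCoherentCut (CoherentResidual)
open Summit.AtomisticToContinuum.Crystallization.Theorems.OverbindingBudgetUniformCutStatements (GrossCleanBallsU)
open Summit.AtomisticToContinuum.Crystallization.Theorems.OverbindingBudgetViolatorDensityFloor (RT)
open Summit.AtomisticToContinuum.Crystallization.Theorems.OverbindingBudgetEdgeRelaxationStatements (CleanClass StrainedCubes)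
open Summit.AtomisticToContinuum.Crystallization.Theorems.OverbindingBudgetRecurrentDustStatements (ViolatorsL)
open Summit.AtomisticToContinuum.Crystallization.Theorems.OverbindingBudgetElasticSplitStatements (SparseCharge LocallyOptimal)
open Summit.AtomisticToContinuum.Crystallization.Theorems.OverbindingBudgetElasticSplitScale (HasCompressedScale CompressedVirialLaw)
open Summit.AtomisticToContinuum.Crystallization.Theorems.OverbindingBudgetElasticSplitPeriodic (PeriodicStrainedCubes)
open Summit.AtomisticToContinuum.Crystallization.Theorems.OverbindingBudgetElasticSplitDoorBridge (CleanCharted)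
open Summit.AtomisticToContinuum.Crystallization.Theorems.ChartedPlanarOrderDoorLayered (TwoPeriodic Layered IsLayered
  isLayered_iff_twoPeriodic_of_isSep DoorPeriodic)
open Summit.AtomisticToContinuum.Crystallization.Theorems.OverbindingBudgetTwoShellTransfer (LocalTwoShellRigidity sep_of_cleanClass)
open Summit.AtomisticToContinuum.Crystallization.Theorems.OverbindingBudgetLimitChargeFreeBall (rdef_of_grossU_doorPeriodic_local)

/-! ## §1 The statements -/

/-- **`UniformlyClean Y`**: at ONE admissible spacing `a' ∈ [47/50, 1]` every site passes `RT a' s` at every margin `s > 0`. -/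
def UniformlyClean (Y : Set (EuclideanSpace ℝ (Fin 3))) : Prop :=
  ∃ a' : ℝ, 47 / 50 ≤ a' ∧ a' ≤ 1 ∧ ∀ y ∈ Y, ∀ s : ℝ, 0 < s → RT a' s Y y

/-- **`PeriodicCleanOrStrained Λ T₀ D`**: a two-periodic texture of the L_opt class is uniformly clean or strained.  Kernel-stronger than
E_per. [piece] -/
def PeriodicCleanOrStrained (Λ T₀ D : ℝ) : Prop :=
  ∀ Y : Set (EuclideanSpace ℝ (Fin 3)), CleanClass T₀ D Y → ¬ HasCompressedScale T₀ Y → SparseCharge Y → LocallyOptimal Y →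
    TwoPeriodic Λ Y → UniformlyClean Y ∨ ∃ κ : ℝ, 0 < κ ∧ StrainedCubes κ Y

/-- **`LayeredCleanOrStrained Λ T₀ D`** — the dichotomy ON THE MODEL `Layered a b w` (independent in-plane generators of length `≤ Λ`, free
per-layer translations).  ATTACKABLE·L by the homogeneous-strain plan of the module docstring. [piece] -/
def LayeredCleanOrStrained (Λ T₀ D : ℝ) : Prop :=
  ∀ (a b : EuclideanSpace ℝ (Fin 3)) (w : ℤ → EuclideanSpace ℝ (Fin 3)), LinearIndependent ℝ ![a, b] → ‖a‖ ≤ Λ → ‖b‖ ≤ Λ →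
    CleanClass T₀ D (Layered a b w) → ¬ HasCompressedScale T₀ (Layered a b w) → SparseCharge (Layered a b w) →
    LocallyOptimal (Layered a b w) → UniformlyClean (Layered a b w) ∨ ∃ κ : ℝ, 0 < κ ∧ StrainedCubes κ (Layered a b w)

/-! ## §2 The seams -/

/-- A uniformly clean texture carries no `t`-robust violator at its clean spacing. [this file] -/
theorem not_violatorsL_of_uniformlyClean {Y : Set (EuclideanSpace ℝ (Fin 3))} (hne : Y.Nonempty) {a' : ℝ}
    (hcl : ∀ y ∈ Y, ∀ s : ℝ, 0 < s → RT a' s Y y) {t : ℝ} (ht : 0 < t) (L : ℝ) : ¬ ViolatorsL a' t L Y := by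
  intro hv
  obtain ⟨q, hq⟩ := hne
  obtain ⟨y, hy, -, hbad⟩ := hv q hq
  exact hbad (t / 2) (by linarith) (by linarith) (hcl y hy (t / 2) (by linarith))

/-- **E_per from the dichotomy.** `PeriodicCleanOrStrained Λ T₀ D → PeriodicStrainedCubes Λ T₀ D`. [this file] -/
theorem periodicStrainedCubes_of_cleanOrStrained {Λ T₀ D : ℝ} (h : PeriodicCleanOrStrained Λ T₀ D) : PeriodicStrainedCubes Λ T₀ D := by
  intro Y hY hnc hsc hlo hper t ht L hviol
  rcases h Y hY hnc hsc hlo hper with ⟨a', ha₁, ha₂, hcl⟩ | hstr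
  · exact absurd (hviol a' ha₁ ha₂) (not_violatorsL_of_uniformlyClean ⟨0, hY.2.1⟩ hcl ht L)
  · exact hstr

/-- **The model carries the dichotomy to all two-periodic textures** (`T₀ ≤ 1/2`): a clean texture is rooted and `((47/50)(49/50) − T₀)`-separated,
so it is two-periodic iff it IS a layered structure (`isLayered_iff_twoPeriodic_of_isSep`). [this file] -/
theorem periodicCleanOrStrained_of_layered {Λ T₀ D : ℝ} (hT : T₀ ≤ 1 / 2) (h : LayeredCleanOrStrained Λ T₀ D) :
    PeriodicCleanOrStrained Λ T₀ D := by
  intro Y hY hnc hsc hlo hper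
  have hδ : (0 : ℝ) < 47 / 50 * (49 / 50) - T₀ := by linarith
  obtain ⟨a, b, hab, ha, hb, w, hYw⟩ := (isLayered_iff_twoPeriodic_of_isSep hδ hY.2.1 (sep_of_cleanClass hY)).2 hper
  subst hYw
  exact h a b w hab ha hb hY hnc hsc hlo

/-- The pieces compose: `LayeredCleanOrStrained Λ T₀ D → PeriodicStrainedCubes Λ T₀ D` (`T₀ ≤ 1/2`). [this file] -/
theorem periodicStrainedCubes_of_layered {Λ T₀ D : ℝ} (hT : T₀ ≤ 1 / 2) (h : LayeredCleanOrStrained Λ T₀ D) : PeriodicStrainedCubes Λ T₀ D :=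
  periodicStrainedCubes_of_cleanOrStrained (periodicCleanOrStrained_of_layered hT h)

/-! ## §3 The cone on the layered model -/

/-- **RDEF cone with the Liouville leaf's energy half on the layered model** (every `Λ`): `GrossCleanBallsU (1/250) 10 → ChargedEnergyGap →
CompressedVirialLaw (1/250) 10 → LocalTwoShellRigidity (1/250) 10 → CleanCharted (1/250) 10 → DoorPeriodic Λ → LayeredCleanOrStrained Λ (1/250) 10 →
CleanlessExcessT → CoherentResidual 10 → RobustDefectLimitWindows`. [this file] -/
theorem rdef_of_grossU_doorPeriodic_layered (Λ : ℝ) (hG : GrossCleanBallsU (1 / 250) 10) (hCEG : ChargedEnergyGap)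
    (hC : CompressedVirialLaw (1 / 250) 10) (hL : LocalTwoShellRigidity (1 / 250) 10) (h₂ : CleanCharted (1 / 250) 10) (hD : DoorPeriodic Λ)
    (hE : LayeredCleanOrStrained Λ (1 / 250) 10) (hCE : CleanlessExcessT) (hR : CoherentResidual 10) : RobustDefectLimitWindows :=
  rdef_of_grossU_doorPeriodic_local Λ hG hCEG hC hL h₂ hD (periodicStrainedCubes_of_layered (by norm_num) hE) hCE hR

end Summit.AtomisticToContinuum.Crystallization.Theorems.OverbindingBudgetPeriodicCleanOrStrained
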